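import Literature.NumberTheory.DiophantineGeometry.GenEllDeBadPlaceDefectOfCrit
import HarnessLib

/-!
# [GenEll] Thm. 2.1 on the `D_e` route, family `t_c`: ONE defect function `p ↦ D_p` for all primes, and the
# `hδ` binder of the mixed separation/defect conductor summation

S. Mochizuki, *Arithmetic elliptic curves in general position*, Math. J. Okayama Univ. **52** (2010), proof
of Thm. 2.1 p. 13 (Prop. 1.6 for the reduced divisor `t⁻¹(B)`) [cite: MochizukiGenEll2010, Thm 2.1 proof p.13].
Support file (proof-only, junction plumbing) for the abc-iut cell's route item `GenEllTwo` (stmt-ABC-19679),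
owner ruling #7 «R-b with defects»: `GenEllDeBadPlaceDefectOfCrit` (abc-iut-w5-d090 over abc-iut-w5-d054's
ramification divisibility) gives, PRIME BY PRIME, a defect `D` with
`ord⁺_w N_c ≤ Σ_{β∈A} ord⁺_w (t − β) + D·e(w∣p)` at every place `w ∣ p` of every number field and every point
(no separation, no good reduction). The consumers (`FibreConductorKappaDefect` /
`GenEllDeFamilySlopeDefect`, abc-iut-w5-d009 / abc-iut-w5-d045) take a FUNCTION `Dp : ℕ → ℕ` fixed before
the field and the point, and the sum over an arbitrary finite `B ⊇ A`. This file makes the two choices once: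

* `DeC.exists_defectFn_of_crit` — `∃ Dp : ℕ → ℕ` serving EVERY prime simultaneously (axiom of choice over
  the primes), with the sum over `A` (read in `L`);
* `DeC.exists_defectFn_hdelta_of_crit` — the same with the sum over any finite `B ⊇ A.map (K → L)` (the extra
  fibres only add nonnegative terms), i.e. VERBATIM the `hδ` binder
  `∀ p ∈ T, p ≠ 2 → ∀ w ∈ placesOver L p, ord⁺_w N ≤ Σ_{b∈B} ord⁺_w (t − b) + Dp p · ramIdx L w`
  of `DeC.slope_of_crit_sep_two_defect` (for every `T`, indeed for every prime, `2` included).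

Classical; nothing here bears on [IUTchIII] Cor. 3.12.
-/

noncomputable section

open NumberField IsDedekindDomain Polynomial Finset
open Literature.IUT.LogVolume

namespace Literature.NumberTheory.DiophantineGeometry.GenEll

universe u v

/-- **One defect function for all primes.** For `k ≥ 1`, `c ≠ 0` in a number field `K`, `R_c` split in
`K` and `A ∋ tCritC c θ` for its roots: there is `Dp : ℕ → ℕ` such that for EVERY prime `p`, every number
field `L ⊇ K`, every place `w ∣ p` and every point `(r, s, t, N)` of the family normal forms with
`r s N ≠ 0` and `t ∉ A`: `ord⁺_w N ≤ Σ_{β∈A} ord⁺_w (t − β) + Dp p · e(w∣p)`.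
[cite: MochizukiGenEll2010, Thm 2.1 proof p.13] -/
theorem DeC.exists_defectFn_of_crit (k : ℕ) (hk : 1 ≤ k)
    {K : Type u} [Field K] [NumberField K] {c : K} (hc : c ≠ 0) (A : Finset K)
    (hsplit : (DeCrit.RpolyC k c).Splits)
    (hA : ∀ θ : K, (DeCrit.RpolyC k c).eval θ = 0 → DeCrit.tCritC k c θ ∈ A) :
    ∃ Dp : ℕ → ℕ, ∀ (p : ℕ), p.Prime → ∀ (L : Type v) [Field L] [NumberField L] [Algebra K L]
      (w : HeightOneSpectrum (𝓞 L)), w ∈ placesOver L p → ∀ (r s t N : L),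
      s ^ 2 = 1 - 4 * r ^ (2 * k + 1) → t * (r * s) = s + algebraMap K L c * r ^ (k + 2) →
      N = -s ^ 3 + algebraMap K L c * ((k + 1) * r ^ (k + 2) - 2 * r ^ (3 * k + 3)) →
      r ≠ 0 → s ≠ 0 → N ≠ 0 → (∀ β ∈ A, t ≠ algebraMap K L β) →
      (ord L w N).toNat ≤ (∑ β ∈ A, (ord L w (t - algebraMap K L β)).toNat) + Dp p * ramIdx L w := by
  classical
  have hFb : ∀ p : ℕ, p.Prime → ∃ D : ℕ, ∀ (L : Type v) [Field L] [NumberField L] [Algebra K L]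
      (w : HeightOneSpectrum (𝓞 L)), w ∈ placesOver L p → ∀ (r s t N : L),
      s ^ 2 = 1 - 4 * r ^ (2 * k + 1) → t * (r * s) = s + algebraMap K L c * r ^ (k + 2) →
      N = -s ^ 3 + algebraMap K L c * ((k + 1) * r ^ (k + 2) - 2 * r ^ (3 * k + 3)) →
      r ≠ 0 → s ≠ 0 → N ≠ 0 → (∀ β ∈ A, t ≠ algebraMap K L β) →
      (ord L w N).toNat ≤ (∑ β ∈ A, (ord L w (t - algebraMap K L β)).toNat) + D * ramIdx L w := by
    intro p hp
    haveI : Fact p.Prime := ⟨hp⟩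
    exact DeC.exists_defect_toNat_ord_le_of_crit p k hk hc A hsplit hA
  choose! D hD using hFb
  exact ⟨D, fun p hp L _ _ _ w hw r s t N hcurve ht hN hr hs hN0 htA =>
    hD p hp L w hw r s t N hcurve ht hN hr hs hN0 htA⟩

/-- **The `hδ` binder of the mixed separation/defect summation**, discharged: with `Dp` from
`DeC.exists_defectFn_of_crit`, for every prime `p` (in particular every `p ∈ T`, `p ≠ 2`), every place
`w ∣ p`, every point as above and every finite `B ⊇ A` (read in `L`):
`ord⁺_w N ≤ Σ_{b∈B} ord⁺_w (t − b) + Dp p · ramIdx L w`. [cite: MochizukiGenEll2010, Thm 2.1 proof p.13] -/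
theorem DeC.exists_defectFn_hdelta_of_crit (k : ℕ) (hk : 1 ≤ k)
    {K : Type u} [Field K] [NumberField K] {c : K} (hc : c ≠ 0) (A : Finset K)
    (hsplit : (DeCrit.RpolyC k c).Splits)
    (hA : ∀ θ : K, (DeCrit.RpolyC k c).eval θ = 0 → DeCrit.tCritC k c θ ∈ A) :
    ∃ Dp : ℕ → ℕ, ∀ (L : Type v) [Field L] [NumberField L] [Algebra K L] (r s t N : L),
      s ^ 2 = 1 - 4 * r ^ (2 * k + 1) → t * (r * s) = s + algebraMap K L c * r ^ (k + 2) →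
      N = -s ^ 3 + algebraMap K L c * ((k + 1) * r ^ (k + 2) - 2 * r ^ (3 * k + 3)) →
      r ≠ 0 → s ≠ 0 → N ≠ 0 →
      ∀ B : Finset L, A.map ⟨algebraMap K L, (algebraMap K L).injective⟩ ⊆ B → (∀ b ∈ B, t ≠ b) →
      ∀ (T : Finset ℕ), (∀ p ∈ T, p.Prime) →
      ∀ p ∈ T, p ≠ 2 → ∀ w ∈ placesOver L p,
        (ord L w N).toNat ≤ (∑ b ∈ B, (ord L w (t - b)).toNat) + Dp p * ramIdx L w := by
  classical
  obtain ⟨Dp, hDp⟩ := DeC.exists_defectFn_of_crit.{u, v} k hk hc A hsplit hA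
  refine ⟨Dp, fun L _ _ _ r s t N hcurve ht hN hr hs hN0 B hAB htB T hT p hp _ w hw => ?_⟩
  have htA : ∀ β ∈ A, t ≠ algebraMap K L β := fun β hβ =>
    htB _ (hAB (Finset.mem_map_of_mem _ hβ))
  refine (hDp p (hT p hp) L w hw r s t N hcurve ht hN hr hs hN0 htA).trans ?_
  gcongr
  calc ∑ β ∈ A, (ord L w (t - algebraMap K L β)).toNat
      = ∑ b ∈ A.map ⟨algebraMap K L, (algebraMap K L).injective⟩, (ord L w (t - b)).toNat := by
        rw [Finset.sum_map]; rfl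
    _ ≤ ∑ b ∈ B, (ord L w (t - b)).toNat := Finset.sum_le_sum_of_subset hAB

end Literature.NumberTheory.DiophantineGeometry.GenEll

end
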